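import Mathlib
import Summits.MatrixMultiplication.MatrixMultiplication.Theorems.SubgroupIdentityDesigns.Negative.BorelDiagonalFamily
import Summits.MatrixMultiplication.MatrixMultiplication.Theorems.SubgroupIdentityDesigns.Negative.BorelVolumeBound
import Summits.MatrixMultiplication.MatrixMultiplication.Theorems.SubgroupIdentityDesigns.Negative.TorusCube
import Literature.NumberTheory.EllipticCurves.BinaryQuarticDiscriminantFpCountProofs

/-!
# The FAIL half of the diagonal-family dichotomy: a covered Borel carries no level-one design
(negative lemma for the crux `SubgroupIdentityDesigns`, stmt-MatrixMultiplication-14079; cell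
B2b-5, gen 6 — report `run/shared/lean/b2b/levelgraded-cu/ORACLE-g6.md` §G6-2, lemma L4)

* `no_levelOne_design_of_borel_covered` — if the triple products `a b g` of `H₁ H₂ H₃ ≤ GL₂(𝔽_p)`
  (`p ≠ 2`) cover the upper Borel `B`, the identity-design clause of the crux fails at
  `(m, k) = (2, 1)`.  Proof: the tested set contains the torus square of full unipotent cosets
  `diag(τ₀, τ₁) U`, `τᵢ ∈ {1, 2}`, through `1`; this is the `k = 1`, `I₀ = {0,1}` instance of the
  landed torus-cube obstruction `no_idTest_of_torusCube` (`Negative.TorusCube`).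
* `diagFamily_fail` — for the diagonal family `(D, R₂^{u₁}, R₃^{u_c})` of
  `Negative.BorelDiagonalFamily`: if the values `c (y₃ - 1) + (y₂ - 1) y₃` (`yᵢ ∈ Rᵢ`) exhaust
  `𝔽_p` then `D R₂^{u₁} R₃^{u_c} = B` and the clause fails.
Together with `diagFamily` (a non-zero missing value gives a TPP design of volume
`(p-1)² |R₂| |R₃|`; the value `0` is always attained at `y₂ = y₃ = 1`) this DECIDES the level-one
design clause on the whole diagonal family by one finite arithmetic condition:
PASS iff `{c (y₃ - 1) + (y₂ - 1) y₃} ≠ 𝔽_p` — the Lean form of the A₁ = D case of the cell's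
structure theorem (ORACLE-g6 §G6-1/§G6-2; census of the family for all `p < 2000` in §G6-3).
Sorry-free; axioms `propext`, `Classical.choice`, `Quot.sound`.  VALUE = a decidable verdict for
one explicit family, NOT summit progress; the crux item stays open and untouched.
-/

set_option linter.dupNamespace false

noncomputable section

open scoped BigOperators Classical
open Summit.MatrixMultiplication.MatrixMultiplication.Theorems.LieRankDesigns.Negative (GLm Mat)

namespace Summit.MatrixMultiplication.MatrixMultiplication.Theorems.SubgroupIdentityDesigns.Negative

variable {p : ℕ} [Fact p.Prime]

section BorelFull

open Literature.Barriers.MatrixMultiplication (SubgroupTPP)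

/-- The points of the `2 × 2` torus cube are the upper-triangular matrices
`[[τ₀, τ₀ e₀₁], [0, τ₁]]`. -/
theorem cubePt_two_eq (α β : Fin 2 → ZMod p) (ε : ↥(Finset.univ : Finset (Fin 2)) → Bool)
    (e : CMat p 2) :
    cubePt Finset.univ α β ε e =
      !![cubeTorus Finset.univ α β ε 0, cubeTorus Finset.univ α β ε 0 * e 0 1;
         0, cubeTorus Finset.univ α β ε 1] := by
  ext i j
  fin_cases i <;> fin_cases j <;>
    simp +decide [cubePt, cubeNil, Matrix.diagonal_mul]

/-- **No level-one design on a covered Borel.**  If the triple products `a b g` (`a ∈ H₁`,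
`b ∈ H₂`, `g ∈ H₃`) cover the whole upper Borel of `GL₂(𝔽_p)`, `p ≠ 2`, then the identity-design
clause of the crux fails at `m = 2`, `k = 1`: the tested set contains the torus square of full
unipotent cosets `diag(τ₀, τ₁)·U`, `τᵢ ∈ {1, 2}`, through `1`, and the landed torus-cube
obstruction `no_idTest_of_torusCube` (`k = 1`, `I₀ = {0, 1}`) kills every level-one test. -/
theorem no_levelOne_design_of_borel_covered (hp : p ≠ 2) {H₁ H₂ H₃ : Subgroup (GLm p 2)}
    (hfull : ∀ s : GLm p 2, (s : Mat p 2) 1 0 = 0 → ∃ a ∈ H₁, ∃ b ∈ H₂, ∃ g ∈ H₃, a * b * g = s) :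
    ¬ ∃ c : Matrix (Fin 2) (Fin 2) (ZMod p) → ℂ, (∀ M, 1 < M.rank → c M = 0) ∧
      (∑ M, c M * ZMod.stdAddChar (Matrix.trace (M * ((1 : GLm p 2) : Mat p 2)))) = 1 ∧
      ∀ a ∈ H₁, ∀ b ∈ H₂, ∀ g ∈ H₃, a * b * g ≠ 1 →
        (∑ M, c M * ZMod.stdAddChar
          (Matrix.trace (M * ((a * b * g : GLm p 2) : Mat p 2)))) = 0 := by
  rintro ⟨c, hc, h1, h0⟩
  have h2 : (2 : ZMod p) ≠ 0 :=
    Literature.NumberTheory.EllipticCurves.BinaryQuartic.two_ne_zero_zmod hp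
  have h21 : (2 : ZMod p) ≠ 1 := fun h => one_ne_zero (by linear_combination h : (1 : ZMod p) = 0)
  have hI : (Finset.univ : Finset (Fin 2)).card = 1 + 1 := by simp
  have hε₁ : cubeTorus (Finset.univ : Finset (Fin 2)) (fun _ => (2 : ZMod p)) (fun _ => 1)
      (fun _ => false) = 1 := by
    funext i
    simp [cubeTorus]
  set S : Set (CMat p 2) :=
    {s | ∃ a ∈ H₁, ∃ b ∈ H₂, ∃ g ∈ H₃, s = ((a * b * g : GLm p 2) : Mat p 2)} with hS_def
  have hS : ∀ (ε : ↥(Finset.univ : Finset (Fin 2)) → Bool) (e : CMat p 2),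
      cubePt Finset.univ (fun _ => (2 : ZMod p)) (fun _ => 1) ε e ∈ S := by
    intro ε e
    set τ := cubeTorus (Finset.univ : Finset (Fin 2)) (fun _ => (2 : ZMod p)) (fun _ => 1) ε
      with hτ
    have hτ0 : ∀ i, τ i ≠ 0 := by
      intro i
      simp only [hτ, cubeTorus, Finset.mem_univ, dif_pos]
      split_ifs
      · exact h2
      · exact one_ne_zero
    obtain ⟨a, ha, b, hb, g, hg, hs⟩ := hfull
      (upperTri (Units.mk0 (τ 0) (hτ0 0)) (Units.mk0 (τ 1) (hτ0 1)) (τ 0 * e 0 1))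
      (upperTri_lower _ _ _)
    refine ⟨a, ha, b, hb, g, hg, ?_⟩
    rw [hs, cubePt_two_eq, upperTri_val, Units.val_mk0, Units.val_mk0]
  have h1' : fourierMat c 1 = 1 := by simpa [fourierMat] using h1
  have h0' : ∀ s ∈ S, s ≠ 1 → fourierMat c s = 0 := by
    rintro s ⟨a, ha, b, hb, g, hg, rfl⟩ hs1
    have hne : a * b * g ≠ 1 := fun h => hs1 (by rw [h, Units.val_one])
    simpa [fourierMat] using h0 a ha b hb g hg hne
  exact no_idTest_of_torusCube 1 Finset.univ hI (fun _ => (2 : ZMod p)) (fun _ => 1)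
    (fun _ _ => h2) (fun _ _ => one_ne_zero) (fun i hi => absurd (Finset.mem_univ i) hi)
    (fun _ _ => h21) (fun _ => false) hε₁ S hS c hc h1' h0'

/-- **The diagonal family fails when `W = 𝔽_p`.**  If the values `c(y₃ - 1) + (y₂ - 1)y₃`
(`y₂ ∈ R₂`, `y₃ ∈ R₃`) exhaust `𝔽_p` then `D · R₂^{u₁} · R₃^{u_c}` is the whole Borel and the
identity-design clause fails (`p ≠ 2`).  Together with `diagFamily` (a missing value `y₀ ≠ 0`
gives a design; `y₀ = 0` is always a value, at `y₂ = y₃ = 1`) this DECIDES the level-one design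
clause on the whole diagonal family: PASS iff `W ≠ 𝔽_p`. -/
theorem diagFamily_fail (hp : p ≠ 2) (R₂ R₃ : Subgroup (ZMod p)ˣ) (c : ZMod p)
    (hW : ∀ t : ZMod p, ∃ y₂ ∈ R₂, ∃ y₃ ∈ R₃,
      c * ((y₃ : ZMod p) - 1) + ((y₂ : ZMod p) - 1) * y₃ = t) :
    ¬ ∃ c' : Matrix (Fin 2) (Fin 2) (ZMod p) → ℂ, (∀ M, 1 < M.rank → c' M = 0) ∧
      (∑ M, c' M * ZMod.stdAddChar (Matrix.trace (M * ((1 : GLm p 2) : Mat p 2)))) = 1 ∧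
      ∀ a ∈ (diagTorus p).range, ∀ b ∈ R₂.map (conjTorus p 1), ∀ g ∈ R₃.map (conjTorus p c),
        a * b * g ≠ 1 →
        (∑ M, c' M * ZMod.stdAddChar
          (Matrix.trace (M * ((a * b * g : GLm p 2) : Mat p 2)))) = 0 := by
  refine no_levelOne_design_of_borel_covered hp fun s hs => ?_
  obtain ⟨hx, hz⟩ := upper_diag_ne_zero s hs
  obtain ⟨y₂, hy₂, y₃, hy₃, hw⟩ := hW ((s : Mat p 2) 0 1 / (s : Mat p 2) 0 0)
  refine ⟨diagTorus p (Units.mk0 _ hx, Units.mk0 _ hz * y₃⁻¹ * y₂⁻¹), ⟨_, rfl⟩,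
    conjTorus p 1 y₂, ⟨y₂, hy₂, rfl⟩, conjTorus p c y₃, ⟨y₃, hy₃, rfl⟩, ?_⟩
  rw [diag_triple, inv_mul_cancel_right, inv_mul_cancel_right, hw]
  refine upper_ext (upperTri_lower _ _ _) hs ?_ ?_ ?_
  · simp
  · simp only [upperTri_val, Units.val_mk0, Matrix.of_apply, Matrix.cons_val',
      Matrix.cons_val_zero, Matrix.cons_val_one, Matrix.empty_val', Matrix.cons_val_fin_one]
    field_simp
  · simp

end BorelFull

end Summit.MatrixMultiplication.MatrixMultiplication.Theorems.SubgroupIdentityDesigns.Negative
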